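import Summits.ABC.ABC.Theses.PadicPrimesW80TwoThirds
import HarnessLib

set_option linter.dupNamespace false

/-!
# Route PadicPrimesW80TwoThirds (rung A1.M2, `stewartYu1991_upperBound`): the `Assembly` (stmt-ABC-19488)

`Summits/ABC/ABC/Theorems/PadicPrimesW80TwoThirdsClosers.lean` — cell `abc-stewartyu`, seat p3 (g2).
The route (planner g4, born 2026-08-26T06:44:40Z) closes `Literature.Barriers.ABC.stewartYu1991_upperBound`
from the three Waldschmidt-shape residue-class texts through p3's landed RESTRICTED Stewart–Yu door
`Literature.Barriers.ABC.stewartYu1991_of_w80Shape` (`BakerMethodBoundsStewartYu1991LineRestrictedProofs.lean`);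
its Assembly item is the route's own deciding theorem `closes`. [folklore] composition.
WHAT THIS IS NOT: the three engine cruxes (`W80ThreeModFour`, `W80OneModFour`, `W80Two`) are untouched.
-/

namespace Summit.ABC.ABC.Theorems

/-- **Item stmt-ABC-19488 `Assembly`** of route `PadicPrimesW80TwoThirds`: `W80ThreeModFour →
W80OneModFour → W80Two → stewartYu1991_upperBound`, by the route's `closes` (door
`stewartYu1991_of_w80Shape`, constants merged). [folklore] -/
theorem padicPrimesW80TwoThirds_assembly_proof :
    Summit.ABC.ABC.Theses.PadicPrimesW80TwoThirds.Assembly :=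
  fun h₃ h₁ h₂ => Summit.ABC.ABC.Theses.PadicPrimesW80TwoThirds.closes h₃ h₁ h₂

end Summit.ABC.ABC.Theorems
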